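import Summits.QuantumFields.YangMills.Theorems.UnitScaleTiltProp7FrameResponseCombSU2T3
import Summits.QuantumFields.YangMills.Theorems.UnitScaleTiltProp7FrameResponseSU2T3
import Summits.QuantumFields.YangMills.Theorems.UnitScaleTiltProp7LegLemmaQTw
import Summits.QuantumFields.YangMills.Theorems.UnitScaleTiltProp7CurvedLandauRowA
import HarnessLib

/-!
# Route `UnitScaleTilt`, crux K1 «MinimiserStabilityRegPr» (stmt-QuantumFields-19200), route-R E′ architecture (A′)-on-Σ, P-A2-COMB route (β) (★p1 g17 WORD 23 (b)) — the displayed row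
# (RL) of px18 g3's (β-ii) BCH door: **THE LINEAR PART OF THE COMB–SYM DIFFERENCE IS THE COARSE GAUGE DERIVATIVE OF THE FRAME-RESPONSE DIFFERENCE**, and that difference is `𝔰𝔲(2)`-valued

Cell `ym3-torus`, D-0154 (3c) twin-width seat `ym-routeR-w2` (gen 8), 2026-08-29 (offer 04:09Z to px18 g3's (β-ii) plan 03:57:25Z «(RL) … ★routeR-w2 g8 `r` letters ∕ ✓LEG §3 + ✓LEG-COMB»).
THEOREMS ONLY (0 `def`, 0 `sorry`); `--supports stmt-QuantumFields-19200 --as helper`, count-neutral.  YM₃ on T³ is a ladder rung (R3), not the Clay problem; nothing here claims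
the stub, the crux, `hcoS`, E′, EX, d = 4 or the mass gap.

WHY.  Route (β) writes the COMB chart remainder as the SYMMETRIC one plus a frame-ratio correction: `U̿^{tw}(A)(c) = g(c₋)·U̿^{twS}(A)(c)·Ad_{D(W)(c)}(g(c₊)⁻¹)` with `g = w^{−1}·w^{S}`
(✓`Prop7CombSymConjugation.dbarTw_eq_conj_dbarTwS`), so `C − C^{S} = [mlog(…) − Y] − [(Q^{tw} − Q^{twS})A]` (✓`CmapTw_sub_CmapTwS_eq`), and the BCH door needs the LINEAR PART
`(Q^{tw} − Q^{twS})A` in closed form.  The two P-A1 LEGs of this lineage give it at once: `Q^{tw}A ĉ = Q A (bondShift ĉ) − D_W̄(r_c A)(ĉ)` (✓`Prop7LegLemmaQTw.QTw_apply_eq_trueLinIter_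
sub_coarseGauge_T3`) and `Q^{twS}A ĉ = Q A (bondShift ĉ) − D_W̄(r_s A)(ĉ)` (✓`Prop7QSymEqTrueLinIter.QTwS_apply_eq_trueLinIter_sub_coarseGauge`), for ANY recursion family `Q` — one exists
(✓`Prop7CurvedLandauRowA.exists_trueLinIter_family`), so the family drops out: `(Q^{tw} − Q^{twS})A ĉ = D_W̄((r_s − r_c)A)(ĉ) = (r_s − r_c)(ĉ₋)A − W̄(ĉ)·(r_s − r_c)(ĉ₊)A·W̄(ĉ)ᴴ`
(px18's `ℓ₁ ĉ + ℓ₂ ĉ`, `Dg(0) = r_s − r_c`).  Both responses are `𝔰𝔲(2)`-valued on `𝔰𝔲(2)`-valued directions (✓F0-COMB `combFrameResponse_mem_skewAdjoint_trace_zero`; px21's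
✓`Prop7FrameResponseSU2.frameResponse_skew_traceless` at base `A₁ := 0`, where `w^{S}_0 = 1`), hence so is their difference.

WHAT IS PROVED (ns `…Theorems.Prop7CombSymLinearPart`; T³, `SU(2)`; `RegPr F n K ε₀ W`, `10¹²L³ε₀ ≤ 1`, which contains the LEGs' `10¹⁰L⁶ε₀ ≤ 1` and F0-COMB's `10⁷L³ε₀ ≤ 1`).
* §1 `ten7_of_ten12` (window arithmetic).
* §2 ★★ `QTw_sub_QTwS_apply_eq` — the (RL) identity, FAMILY-FREE.
* §3 ★ `symFrameResponse_mem_skewAdjoint_trace_zero` (px21's brick at `A₁ := 0`, in `skewAdjoint` letters) · ★★ `frameResponseDiff_mem_skewAdjoint_trace_zero` — `(r_s − r_c)(y)A ∈ 𝔰𝔲(2)`.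
HONEST SCOPE.  Algebra over landed theorems; no estimate; nothing of print asserted.

References: T. Bałaban, CMP 98 (1985) 17–51 [Balaban1985Averaging] ((87)–(92) p.31, (97) p.32, (125)–(127) p.36); CMP 99 (1985) 389–434 [Balaban1985BackgroundPropagators]
((3.14)–(3.15) p.393); CMP 102 (1985) 277–309 [Balaban1985Variational] ((44)–(48) p.285, (51) p.286).
-/

set_option autoImplicit false

noncomputable section

open scoped BigOperators Matrix.Norms.L2Operator Matrix Topology

namespace Summit.QuantumFields.YangMills.Theorems.Prop7CombSymLinearPart

open Literature.MathematicalPhysics.QuantumFieldTheory.Balaban1983to89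
open Literature.MathematicalPhysics.QuantumFieldTheory.Balaban1983to89.T3ContinuumYM3Torus
open T4Continuum BlockAveraging AveragingRT ExpMeanLog BlockAveragingEMLLinearised BlockAveragingEMLLinearisedBackground BlockAveragingEMLProp2
open T3PrintedRegularMinimiser (RegPr)
open T3LevelShift (bondShift)
open T3PrintedRegularOrbits (sites_eq)
open T3SectALandauChart (eta eta_pos)
open Summit.QuantumFields.YangMills.Theorems.Prop7SymAvgTw (frameTw QTw)
open Summit.QuantumFields.YangMills.Theorems.Prop7SymAvgTwSym (frameTwS QTwS frameTwS_zero)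
open Summit.QuantumFields.YangMills.Theorems.Prop7LegLemmaQTw (QTw_apply_eq_trueLinIter_sub_coarseGauge_T3)
open Summit.QuantumFields.YangMills.Theorems.Prop7QSymEqTrueLinIter (QTwS_apply_eq_trueLinIter_sub_coarseGauge)
open Summit.QuantumFields.YangMills.Theorems.Prop7CurvedLandauRowA (exists_trueLinIter_family)
open Summit.QuantumFields.YangMills.Theorems.Prop7FrameResponseCombSU2 (combFrameResponse_mem_skewAdjoint_trace_zero)
open Summit.QuantumFields.YangMills.Theorems.Prop7FrameResponseSU2 (frameResponse_skew_traceless)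

variable (F : T3Family) {n K : ℕ} (h : n ≤ K)

/-! ## §1 Window arithmetic -/

/-- `10¹²L³ε₀ ≤ 1 ⟹ 10⁷L³ε₀ ≤ 1` (F0-COMB's window inside the LEG-TwS window; the LEGs' `10¹⁰L⁶ε₀ ≤ 1` is independent and stays a hypothesis). [folklore] -/
theorem ten7_of_ten12 {ε₀ : ℝ} (hε₀ : 0 ≤ ε₀) (hε12 : 10 ^ 12 * (F.L : ℝ) ^ 3 * ε₀ ≤ 1) : 10 ^ 7 * (F.L : ℝ) ^ 3 * ε₀ ≤ 1 := by
  have h0 : 0 ≤ (F.L : ℝ) ^ 3 * ε₀ := by positivity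
  nlinarith

/-! ## §2 ★★ (RL): the linear part of the comb–sym difference, family-free -/

/-- ★★ **(RL) — THE LINEAR PART OF THE COMB–SYM DIFFERENCE IS THE COARSE GAUGE DERIVATIVE OF THE FRAME-RESPONSE DIFFERENCE**: at a printed-regular `W` (`RegPr F n K ε₀ W`,
`10¹⁰L⁶ε₀ ≤ 1`, `10¹²L³ε₀ ≤ 1`), for every bondwise skew-adjoint traceless `A` and every comparison bond `ĉ`,
`QTw W A ĉ − QTwS W A ĉ = (r_s(ĉ₋)A − r_c(ĉ₋)A) − W̄(ĉ)·(r_s(ĉ₊)A − r_c(ĉ₊)A)·W̄(ĉ)ᴴ`, `r_c(y)A = fderiv ℂ (A ↦ ↑(frameTw W A y)) 0 A`, `r_s(y)A = fderiv ℂ (A ↦ ↑(frameTwS W A y)) 0 A`,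
`W̄(ĉ) = W̄^{(K−n)}(bondShift ĉ)` — the two LEGs subtracted; the recursion family `Q` (any; one exists) cancels.
[cite: Balaban1985Averaging, (125)-(127) p.36, (89)-(92) p.31, (97) p.32; Balaban1985BackgroundPropagators, (3.14)-(3.15) p.393; Balaban1985Variational, (44)-(48) p.285] -/
theorem QTw_sub_QTwS_apply_eq {ε₀ : ℝ} (hε₀ : 0 < ε₀) (hε : 10 ^ 10 * (F.L : ℝ) ^ 6 * ε₀ ≤ 1) (hε12 : 10 ^ 12 * (F.L : ℝ) ^ 3 * ε₀ ≤ 1)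
    (W : GaugeField (F.P K) 0 (Matrix.specialUnitaryGroup (Fin 2) ℂ)) (hreg : RegPr F n K ε₀ W)
    (A : PBond (F.P K) 0 → Matrix (Fin 2) (Fin 2) ℂ) (hA : ∀ b, A b ∈ skewAdjoint (Matrix (Fin 2) (Fin 2) ℂ)) (htr : ∀ b, (A b).trace = 0)
    (c : PBond (F.P n) 0) :
    QTw F n K h W A c - QTwS F n K h W A c
      = (fderiv ℂ (fun A : PBond (F.P K) 0 → Matrix (Fin 2) (Fin 2) ℂ => ((frameTwS F n K h W A c.src : (Matrix (Fin 2) (Fin 2) ℂ)ˣ) : Matrix (Fin 2) (Fin 2) ℂ)) 0 A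
          - fderiv ℂ (fun A : PBond (F.P K) 0 → Matrix (Fin 2) (Fin 2) ℂ => ((frameTw F n K h W A c.src : (Matrix (Fin 2) (Fin 2) ℂ)ˣ) : Matrix (Fin 2) (Fin 2) ℂ)) 0 A)
        - ((Averaging.iter (fun i => blockAvg (P := F.P K) (j := i) (expMeanLogSU (n := Fin 2))) (K - n) W (bondShift (sites_eq F n K h) c) :
              Matrix.specialUnitaryGroup (Fin 2) ℂ) : Matrix (Fin 2) (Fin 2) ℂ)
          * (fderiv ℂ (fun A : PBond (F.P K) 0 → Matrix (Fin 2) (Fin 2) ℂ => ((frameTwS F n K h W A c.tgt : (Matrix (Fin 2) (Fin 2) ℂ)ˣ) : Matrix (Fin 2) (Fin 2) ℂ)) 0 A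
              - fderiv ℂ (fun A : PBond (F.P K) 0 → Matrix (Fin 2) (Fin 2) ℂ => ((frameTw F n K h W A c.tgt : (Matrix (Fin 2) (Fin 2) ℂ)ˣ) : Matrix (Fin 2) (Fin 2) ℂ)) 0 A)
          * star ((Averaging.iter (fun i => blockAvg (P := F.P K) (j := i) (expMeanLogSU (n := Fin 2))) (K - n) W (bondShift (sites_eq F n K h) c) :
              Matrix.specialUnitaryGroup (Fin 2) ℂ) : Matrix (Fin 2) (Fin 2) ℂ) := by
  obtain ⟨Q, hQ0, hQs⟩ := exists_trueLinIter_family (P := F.P K) W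
  rw [QTw_apply_eq_trueLinIter_sub_coarseGauge_T3 F h hε₀ hε W hreg Q hQ0 hQs A hA htr c,
    QTwS_apply_eq_trueLinIter_sub_coarseGauge F h hε₀ hε hε12 W hreg Q hQ0 hQs A hA htr c]
  noncomm_ring

/-! ## §3 The frame-response difference is `𝔰𝔲(2)`-valued -/

/-- ★ **THE SYMMETRIC FRAME RESPONSE AT THE ORIGIN IS `𝔰𝔲(2)`-VALUED** — px21's ✓`Prop7FrameResponseSU2.frameResponse_skew_traceless` at base `A₁ := 0` (`w^{S}_0 = 1`, so the right
trivialisation is trivial), in `skewAdjoint` letters: for `W ∈ 𝔘_k(ε₀)` (`10¹²L³ε₀ ≤ 1`) and bondwise skew-adjoint traceless `A`, `fderiv ℂ (A ↦ ↑(frameTwS W A y)) 0 A ∈ skewAdjoint ∧ tr = 0`.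
[cite: Balaban1985Averaging, (97) p.32, (87)-(92) p.31; Balaban1985Variational, (51) p.286] -/
theorem symFrameResponse_mem_skewAdjoint_trace_zero {ε₀ : ℝ} (hε₀ : 0 < ε₀) (hε12 : 10 ^ 12 * (F.L : ℝ) ^ 3 * ε₀ ≤ 1)
    (W : GaugeField (F.P K) 0 (Matrix.specialUnitaryGroup (Fin 2) ℂ)) (hreg : RegPr F n K ε₀ W)
    {A : PBond (F.P K) 0 → Matrix (Fin 2) (Fin 2) ℂ} (hA : ∀ b, A b ∈ skewAdjoint (Matrix (Fin 2) (Fin 2) ℂ)) (htr : ∀ b, (A b).trace = 0) (y : Site (F.P n) 0) :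
    fderiv ℂ (fun A : PBond (F.P K) 0 → Matrix (Fin 2) (Fin 2) ℂ => ((frameTwS F n K h W A y : (Matrix (Fin 2) (Fin 2) ℂ)ˣ) : Matrix (Fin 2) (Fin 2) ℂ)) 0 A
        ∈ skewAdjoint (Matrix (Fin 2) (Fin 2) ℂ) ∧
      Matrix.trace (fderiv ℂ (fun A : PBond (F.P K) 0 → Matrix (Fin 2) (Fin 2) ℂ => ((frameTwS F n K h W A y : (Matrix (Fin 2) (Fin 2) ℂ)ˣ) : Matrix (Fin 2) (Fin 2) ℂ)) 0 A) = 0 := by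
  -- the radius `e := (10⁹L²)⁻¹` of px21's brick, with `‖0‖ < e·η`
  have hL0 : (0 : ℝ) < (F.L : ℝ) := by exact_mod_cast F.hL.2.le.trans_lt' (by norm_num)
  set e : ℝ := (10 ^ 9 * (F.L : ℝ) ^ 2)⁻¹ with he_def
  have he : 0 < e := by rw [he_def]; positivity
  have hWe : 10 ^ 9 * (F.L : ℝ) ^ 2 * e ≤ 1 := by
    rw [he_def, mul_inv_cancel₀ (by positivity)]
  have hA0 : ‖(0 : PBond (F.P K) 0 → Matrix (Fin 2) (Fin 2) ℂ)‖ < e * eta F n K := by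
    rw [norm_zero]; exact mul_pos he (eta_pos F n K)
  have hAR : ∀ b, star (A b) = -A b ∧ (A b).trace = 0 := fun b => ⟨(skewAdjoint.mem_iff).1 (hA b), htr b⟩
  have h0R : ∀ b, star ((0 : PBond (F.P K) 0 → Matrix (Fin 2) (Fin 2) ℂ) b) = -(0 : PBond (F.P K) 0 → Matrix (Fin 2) (Fin 2) ℂ) b ∧
      ((0 : PBond (F.P K) 0 → Matrix (Fin 2) (Fin 2) ℂ) b).trace = 0 := fun b => by simp
  have hb := frameResponse_skew_traceless F h hε₀ he hWe hε12 W hreg hA0 h0R hAR y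
  simp only [frameTwS_zero, inv_one, Units.val_one, mul_one] at hb
  exact ⟨(skewAdjoint.mem_iff).2 hb.1, hb.2⟩

/-- ★★ **THE FRAME-RESPONSE DIFFERENCE `(r_s − r_c)(y)A` IS `𝔰𝔲(2)`-VALUED** on `𝔰𝔲(2)`-valued directions (`W ∈ 𝔘_k(ε₀)`, `10¹²L³ε₀ ≤ 1`): §3's symmetric brick minus ✓F0-COMB's comb brick
(`skewAdjoint` is an additive subgroup, `tr` is linear) — px18's `Dg(0)A ∈ 𝔰𝔲(2)`, the reality of (RL)'s gauge parameter.
[cite: Balaban1985Averaging, (97) p.32; Balaban1985Variational, (51) p.286, (123)-(126) pp.296-297] -/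
theorem frameResponseDiff_mem_skewAdjoint_trace_zero {ε₀ : ℝ} (hε₀ : 0 < ε₀) (hε12 : 10 ^ 12 * (F.L : ℝ) ^ 3 * ε₀ ≤ 1)
    (W : GaugeField (F.P K) 0 (Matrix.specialUnitaryGroup (Fin 2) ℂ)) (hreg : RegPr F n K ε₀ W)
    {A : PBond (F.P K) 0 → Matrix (Fin 2) (Fin 2) ℂ} (hA : ∀ b, A b ∈ skewAdjoint (Matrix (Fin 2) (Fin 2) ℂ)) (htr : ∀ b, (A b).trace = 0) (y : Site (F.P n) 0) :
    (fderiv ℂ (fun A : PBond (F.P K) 0 → Matrix (Fin 2) (Fin 2) ℂ => ((frameTwS F n K h W A y : (Matrix (Fin 2) (Fin 2) ℂ)ˣ) : Matrix (Fin 2) (Fin 2) ℂ)) 0 A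
        - fderiv ℂ (fun A : PBond (F.P K) 0 → Matrix (Fin 2) (Fin 2) ℂ => ((frameTw F n K h W A y : (Matrix (Fin 2) (Fin 2) ℂ)ˣ) : Matrix (Fin 2) (Fin 2) ℂ)) 0 A)
        ∈ skewAdjoint (Matrix (Fin 2) (Fin 2) ℂ) ∧
      Matrix.trace (fderiv ℂ (fun A : PBond (F.P K) 0 → Matrix (Fin 2) (Fin 2) ℂ => ((frameTwS F n K h W A y : (Matrix (Fin 2) (Fin 2) ℂ)ˣ) : Matrix (Fin 2) (Fin 2) ℂ)) 0 A
        - fderiv ℂ (fun A : PBond (F.P K) 0 → Matrix (Fin 2) (Fin 2) ℂ => ((frameTw F n K h W A y : (Matrix (Fin 2) (Fin 2) ℂ)ˣ) : Matrix (Fin 2) (Fin 2) ℂ)) 0 A) = 0 := by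
  obtain ⟨hs1, hs2⟩ := symFrameResponse_mem_skewAdjoint_trace_zero F h hε₀ hε12 W hreg hA htr y
  obtain ⟨hc1, hc2⟩ := combFrameResponse_mem_skewAdjoint_trace_zero F h hε₀ (ten7_of_ten12 F hε₀.le hε12) W hreg hA htr y
  exact ⟨(skewAdjoint (Matrix (Fin 2) (Fin 2) ℂ)).sub_mem hs1 hc1, by rw [Matrix.trace_sub, hs2, hc2, sub_zero]⟩

/-! ## §4 (v1.1, pure append) (RL) IN (β-i)'s LETTERS: the conjugation by `D̄₀(ĉ) = descendToGL (bgUnits W) ĉ` (routeR-w4 g15's seam (iii), for px18's `ℓ₂`) -/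

open T3SectALandauChart (bgUnits) in
open Summit.QuantumFields.YangMills.Theorems.Prop7SymAvgGL (descendToGL) in
open Summit.QuantumFields.YangMills.Theorems.Prop7QSymEqTrueLinIter (coe_descendToGL_bgUnits coe_descendToGL_bgUnits_inv) in
/-- ★★ **(RL) WITH THE COARSE CONJUGATION READ AS `D̄₀(ĉ)·(…)·D̄₀(ĉ)⁻¹`** — the (β-i)∕(β-ii) doors (✓`Prop7CombSymConjugation`, ✓`Prop7CombSymBCHDoor`) conjugate by the GL descent
`descendToGL F n K h (bgUnits F K W) ĉ` and its inverse, while §2 (from the LEGs) conjugates by `↑(W̄^{(K−n)}(bondShift ĉ))` and its `star`; at a printed-regular `W` these are the same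
matrices (✓`Prop7QSymEqTrueLinIter.coe_descendToGL_bgUnits ∕ _inv`, window `10⁷L³ε₀ ≤ 1`).  So, in px18's letters: `QTw W A ĉ − QTwS W A ĉ = ℓ₁ ĉ + ℓ₂ ĉ` with
`ℓ₁ ĉ := (r_s − r_c)(ĉ₋)A` and `ℓ₂ ĉ := −(↑(D̄₀ ĉ)·(r_s − r_c)(ĉ₊)A·↑((D̄₀ ĉ)⁻¹))`.
[cite: Balaban1985Averaging, (125)-(127) p.36, (89)-(92) p.31; Balaban1985BackgroundPropagators, (3.14)-(3.15) p.393; Balaban1987RG1, (0.4) p.253] -/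
theorem QTw_sub_QTwS_apply_eq_descendToGL {ε₀ : ℝ} (hε₀ : 0 < ε₀) (hε : 10 ^ 10 * (F.L : ℝ) ^ 6 * ε₀ ≤ 1) (hε12 : 10 ^ 12 * (F.L : ℝ) ^ 3 * ε₀ ≤ 1)
    (W : GaugeField (F.P K) 0 (Matrix.specialUnitaryGroup (Fin 2) ℂ)) (hreg : RegPr F n K ε₀ W)
    (A : PBond (F.P K) 0 → Matrix (Fin 2) (Fin 2) ℂ) (hA : ∀ b, A b ∈ skewAdjoint (Matrix (Fin 2) (Fin 2) ℂ)) (htr : ∀ b, (A b).trace = 0)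
    (c : PBond (F.P n) 0) :
    QTw F n K h W A c - QTwS F n K h W A c
      = (fderiv ℂ (fun A : PBond (F.P K) 0 → Matrix (Fin 2) (Fin 2) ℂ => ((frameTwS F n K h W A c.src : (Matrix (Fin 2) (Fin 2) ℂ)ˣ) : Matrix (Fin 2) (Fin 2) ℂ)) 0 A
          - fderiv ℂ (fun A : PBond (F.P K) 0 → Matrix (Fin 2) (Fin 2) ℂ => ((frameTw F n K h W A c.src : (Matrix (Fin 2) (Fin 2) ℂ)ˣ) : Matrix (Fin 2) (Fin 2) ℂ)) 0 A)
        + -(((descendToGL F n K h (bgUnits F K W) c : (Matrix (Fin 2) (Fin 2) ℂ)ˣ) : Matrix (Fin 2) (Fin 2) ℂ)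
          * (fderiv ℂ (fun A : PBond (F.P K) 0 → Matrix (Fin 2) (Fin 2) ℂ => ((frameTwS F n K h W A c.tgt : (Matrix (Fin 2) (Fin 2) ℂ)ˣ) : Matrix (Fin 2) (Fin 2) ℂ)) 0 A
              - fderiv ℂ (fun A : PBond (F.P K) 0 → Matrix (Fin 2) (Fin 2) ℂ => ((frameTw F n K h W A c.tgt : (Matrix (Fin 2) (Fin 2) ℂ)ˣ) : Matrix (Fin 2) (Fin 2) ℂ)) 0 A)
          * (((descendToGL F n K h (bgUnits F K W) c)⁻¹ : (Matrix (Fin 2) (Fin 2) ℂ)ˣ) : Matrix (Fin 2) (Fin 2) ℂ)) := by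
  have hε7 : 10 ^ 7 * (F.L : ℝ) ^ 3 * ε₀ ≤ 1 := ten7_of_ten12 F hε₀.le hε12
  rw [coe_descendToGL_bgUnits F h hε₀ hε7 W hreg.1 c, coe_descendToGL_bgUnits_inv F h hε₀ hε7 W hreg.1 c,
    QTw_sub_QTwS_apply_eq F h hε₀ hε hε12 W hreg A hA htr c, ← sub_eq_add_neg]

end Summit.QuantumFields.YangMills.Theorems.Prop7CombSymLinearPart

end
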